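import Summits.CriticalPhenomena.SAWScalingLimit.Theorems.SAWRestrictionRigidityLimitExists
import Summits.CriticalPhenomena.SAWScalingLimit.Theorems.SimpleSubseqLimits.Negative.SimpleSubseqLimitsFalseWithoutEndpointLimits
import Mathlib.MeasureTheory.Measure.HasOuterApproxClosed
import HarnessLib

/-!
# `LimitExists` (crux stmt-CriticalPhenomena-1371) — the POINTWISE form of the crux

Route `SAWRestrictionRigidity` of `CriticalPhenomena/SAWScalingLimit` (crux shared verbatim by seven further SAW
routes); line `registered` (`Cruxes/LimitExists/Lines/birth.lean`), lead c3.

The crux reads `∃ P : ChordalFamily, P.IsChordal ∧ ∀ D a b, IsEndpointApprox D a b → TendstoLaw curve law id (P D)`: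
ONE limit law `P D` per Dobrushin domain serving EVERY endpoint approximation, chordal.  This file proves that the
`∃ P ∀ D` commutation, the consistency across endpoint approximations and the chordality are all FREE:

* `integral_eq_of_tendstoLaw` / `eq_of_tendstoLaw` — if EVERY endpoint approximation of `D` has SOME full-filter
  weak limit, then the limits along two approximations coincide (interleave the two approximations on the
  irrational meshes, `isEndpointApprox_piecewise`; the interleaved family has a limit by hypothesis, and each strand
  sees it, `eq_of_tendsto_piecewise'`; finite Borel measures on the metric curve space with equal bounded continuous
  integrals are equal, `ext_of_forall_integral_eq_of_IsFiniteMeasure`);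
* `isProbabilityMeasure_of_tendstoLaw`, `ae_chordal_of_tendstoLaw` — a full-filter weak limit of the pushed critical
  SAW laws is a probability measure carried by curves from `a` to `b` inside `cl D` (tree lemmas along the mesh
  sequence `1/(n+1)`, `tendsto_one_div_succ`);
* **`limitExists_iff_forall_exists_tendstoLaw : LimitExists ↔ ∀ D a b, IsEndpointApprox D a b → ∃ ν, TendstoLaw curve
  law id ν`** — the crux is LITERALLY "for each Dobrushin domain and each endpoint approximation, the critical `δℤ²`
  SAW law, pushed to curve classes, converges weakly along `δ → 0⁺` to some measure".

Everything proved, standard axioms; no named fact is used. [folklore]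
-/

noncomputable section

open MeasureTheory Filter Topology Set Metric Function
open Literature.Probability.RandomPlanarGeometry Literature.Probability.RandomPlanarGeometry.SAW
open Literature.Probability.LatticeModels
open scoped ENNReal NNReal BoundedContinuousFunction Topology

namespace Summit.CriticalPhenomena.SAWScalingLimit.Theorems.SAWRestrictionRigidityLimitExists

open Summit.CriticalPhenomena.SAWScalingLimit.Theses.SAWRestrictionRigidity (LimitExists)
open Summit.CriticalPhenomena.SAWScalingLimit.Theorems.SubseqIdentification.Negative
  (isProbabilityMeasure_of_hyps ae_endpoints_of_hyps ae_range_subset_closure_of_hyps)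
open Summit.CriticalPhenomena.SAWScalingLimit.Theorems.SimpleSubseqLimits.Negative (tendsto_one_div_succ)

/-- **Limits along an interleaved approximation are seen by each strand** (Hausdorff-valued version of
`eq_of_tendsto_piecewise`).  If a mesh functional of the interleaved endpoints `(S.piecewise a a', S.piecewise b b')`
tends to `c''` along `𝓝[>] 0` and the functional of the strand `(a, b)` tends to `c`, then `c = c''` as soon as `S`
accumulates at `0⁺`. [folklore] -/
theorem eq_of_tendsto_piecewise' {β : Type*} [TopologicalSpace β] [T2Space β]
    {g : ℝ → Site 2 → Site 2 → β} {a b a' b' : ℝ → Site 2}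
    {S : Set ℝ} [∀ x, Decidable (x ∈ S)] (hS : (𝓝[>] (0 : ℝ) ⊓ 𝓟 S).NeBot) {c c'' : β}
    (hc : Tendsto (fun δ => g δ (a δ) (b δ)) (𝓝[>] (0 : ℝ)) (𝓝 c))
    (hc'' : Tendsto (fun δ => g δ (S.piecewise a a' δ) (S.piecewise b b' δ)) (𝓝[>] (0 : ℝ))
      (𝓝 c'')) : c = c'' := by
  haveI := hS
  refine tendsto_nhds_unique (l := 𝓝[>] (0 : ℝ) ⊓ 𝓟 S) (hc.mono_left inf_le_left)
    ((hc''.mono_left inf_le_left).congr' ?_)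
  exact eventually_inf_principal.2 (Eventually.of_forall fun δ hδ => by
    simp only [piecewise_eq_of_mem _ _ _ hδ])

variable {D : DobrushinDomain} {a b a' b' : ℝ → Site 2}

/-- **Full-filter weak limits are approximation-free (integrals).**  If every endpoint approximation of `D` has
some full-filter weak limit of its pushed critical SAW laws, then two such limits `ν` (along `(a, b)`) and `ν'`
(along `(a', b')`) have the same bounded continuous integrals: interleave `(a, b)` and `(a', b')` on the
irrational meshes; the interleaved approximation is honest (`isEndpointApprox_piecewise`), has a limit `ν''` by
hypothesis, and both strands see it (`eq_of_tendsto_piecewise'`). [folklore] -/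
theorem integral_eq_of_tendstoLaw
    (hall : ∀ a'' b'' : ℝ → Site 2, IsEndpointApprox D a'' b'' → ∃ ν'' : Measure (CurveClass ℂ),
      TendstoLaw (fun δ (γ : DomainSAW D.carrier δ (a'' δ) (b'' δ)) => γ.curve)
        (fun δ => law D.carrier δ (a'' δ) (b'' δ)) id ν'')
    (hab : IsEndpointApprox D a b) (hab' : IsEndpointApprox D a' b') {ν ν' : Measure (CurveClass ℂ)}
    (hν : TendstoLaw (fun δ (γ : DomainSAW D.carrier δ (a δ) (b δ)) => γ.curve)
      (fun δ => law D.carrier δ (a δ) (b δ)) id ν)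
    (hν' : TendstoLaw (fun δ (γ : DomainSAW D.carrier δ (a' δ) (b' δ)) => γ.curve)
      (fun δ => law D.carrier δ (a' δ) (b' δ)) id ν')
    (f : CurveClass ℂ →ᵇ ℝ) : ∫ x, f x ∂ν = ∫ x, f x ∂ν' := by
  classical
  obtain ⟨S, hS, hS'⟩ := exists_interleavingSet
  obtain ⟨ν'', hν''⟩ := hall _ _ (isEndpointApprox_piecewise S hab hab')
  -- the mesh functional `(δ, x, y) ↦ ∫ f (γ.curve) dlaw_δ(x, y)`
  have h₁ : ∫ x, f x ∂ν = ∫ x, f x ∂ν'' := by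
    have := eq_of_tendsto_piecewise' (g := fun δ x y => ∫ γ, f γ.curve ∂(law D.carrier δ x y))
      (a := a) (b := b) (a' := a') (b' := b') hS (by simpa using hν f) (by simpa using hν'' f)
    simpa using this
  have h₂ : ∫ x, f x ∂ν' = ∫ x, f x ∂ν'' := by
    have e₁ : Sᶜ.piecewise a' a = S.piecewise a a' := Set.piecewise_compl S a' a
    have e₂ : Sᶜ.piecewise b' b = S.piecewise b b' := Set.piecewise_compl S b' b
    have := eq_of_tendsto_piecewise' (g := fun δ x y => ∫ γ, f γ.curve ∂(law D.carrier δ x y))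
      (S := Sᶜ) (a := a') (b := b') (a' := a) (b' := b) hS' (by simpa using hν' f)
      (by rw [e₁, e₂]; simpa using hν'' f)
    simpa using this
  exact h₁.trans h₂.symm

/-- **A full-filter weak limit of the pushed critical SAW laws is a probability measure**: the laws are
probability measures for all small meshes (`IsEndpointApprox.reachable`), test with `f = 1` along the mesh sequence
`1/(n+1)` (tree lemma `isProbabilityMeasure_of_hyps`). [folklore] -/
theorem isProbabilityMeasure_of_tendstoLaw (hab : IsEndpointApprox D a b) {ν : Measure (CurveClass ℂ)}
    (hν : TendstoLaw (fun δ (γ : DomainSAW D.carrier δ (a δ) (b δ)) => γ.curve)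
      (fun δ => law D.carrier δ (a δ) (b δ)) id ν) :
    IsProbabilityMeasure ν :=
  isProbabilityMeasure_of_hyps hab tendsto_one_div_succ
    (fun f => (hν f).comp tendsto_one_div_succ)

/-- **A full-filter weak limit of the pushed critical SAW laws is chordal**: carried by curves from `a = D.pt 0`
to `b = D.pt 1` inside `cl D` (tree lemmas `ae_endpoints_of_hyps`, `ae_range_subset_closure_of_hyps` along the
mesh sequence `1/(n+1)`). [folklore] -/
theorem ae_chordal_of_tendstoLaw (hab : IsEndpointApprox D a b) {ν : Measure (CurveClass ℂ)}
    (hν : TendstoLaw (fun δ (γ : DomainSAW D.carrier δ (a δ) (b δ)) => γ.curve)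
      (fun δ => law D.carrier δ (a δ) (b δ)) id ν) :
    ∀ᵐ γ ∂ν, γ.source = D.pt 0 ∧ γ.target = D.pt 1 ∧ γ.range ⊆ closure D.carrier := by
  haveI := isProbabilityMeasure_of_tendstoLaw hab hν
  have hlim : ∀ f : CurveClass ℂ →ᵇ ℝ, Tendsto (fun n : ℕ => ∫ γ, f γ.curve
      ∂(law D.carrier (1 / ((n : ℝ) + 1)) (a (1 / ((n : ℝ) + 1))) (b (1 / ((n : ℝ) + 1)))))
      atTop (𝓝 (∫ x, f x ∂ν)) :=
    fun f => (hν f).comp tendsto_one_div_succ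
  filter_upwards [ae_endpoints_of_hyps hab tendsto_one_div_succ hlim,
    ae_range_subset_closure_of_hyps hab tendsto_one_div_succ hlim] with γ h1 h2
  exact ⟨h1.1, h1.2, h2⟩

/-- **Full-filter weak limits are approximation-free (measures).**  Under the hypothesis of
`integral_eq_of_tendstoLaw`, two full-filter weak limits of one Dobrushin domain along two endpoint approximations
are EQUAL measures (both are probability measures; finite Borel measures on the metric space `CurveClass ℂ` with the
same bounded continuous integrals coincide, `ext_of_forall_integral_eq_of_IsFiniteMeasure`). [folklore] -/
theorem eq_of_tendstoLaw
    (hall : ∀ a'' b'' : ℝ → Site 2, IsEndpointApprox D a'' b'' → ∃ ν'' : Measure (CurveClass ℂ),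
      TendstoLaw (fun δ (γ : DomainSAW D.carrier δ (a'' δ) (b'' δ)) => γ.curve)
        (fun δ => law D.carrier δ (a'' δ) (b'' δ)) id ν'')
    (hab : IsEndpointApprox D a b) (hab' : IsEndpointApprox D a' b') {ν ν' : Measure (CurveClass ℂ)}
    (hν : TendstoLaw (fun δ (γ : DomainSAW D.carrier δ (a δ) (b δ)) => γ.curve)
      (fun δ => law D.carrier δ (a δ) (b δ)) id ν)
    (hν' : TendstoLaw (fun δ (γ : DomainSAW D.carrier δ (a' δ) (b' δ)) => γ.curve)
      (fun δ => law D.carrier δ (a' δ) (b' δ)) id ν') : ν = ν' := by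
  haveI := isProbabilityMeasure_of_tendstoLaw hab hν
  haveI := isProbabilityMeasure_of_tendstoLaw hab' hν'
  exact ext_of_forall_integral_eq_of_IsFiniteMeasure (integral_eq_of_tendstoLaw hall hab hab' hν hν')

/-- **The pointwise form of the crux.**  `LimitExists` — ONE chordal limit law per Dobrushin domain serving every
endpoint approximation — is equivalent to the bare statement that for each Dobrushin domain `D` and each endpoint
approximation `(a, b)` the pushed critical `δℤ²` SAW laws converge weakly along `δ → 0⁺` to SOME measure: the
limit is automatically a probability measure (`isProbabilityMeasure_of_tendstoLaw`), chordal
(`ae_chordal_of_tendstoLaw`) and independent of the approximation (`eq_of_tendstoLaw`, interleaving), so the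
family of limits along one reference approximation per domain (`SAW.exists_isEndpointApprox`) witnesses `P`.
[folklore] -/
theorem limitExists_iff_forall_exists_tendstoLaw : Summit.CriticalPhenomena.SAWScalingLimit.Theses.SAWRestrictionRigidity.LimitExists ↔ ∀ (D : Literature.Probability.RandomPlanarGeometry.DobrushinDomain) (a b : ℝ → Literature.Probability.LatticeModels.Site 2), Literature.Probability.RandomPlanarGeometry.SAW.IsEndpointApprox D a b → ∃ ν : MeasureTheory.Measure (Literature.Probability.RandomPlanarGeometry.CurveClass ℂ), Literature.Probability.RandomPlanarGeometry.TendstoLaw (fun δ (γ : Literature.Probability.RandomPlanarGeometry.SAW.DomainSAW D.carrier δ (a δ) (b δ)) => γ.curve) (fun δ => Literature.Probability.RandomPlanarGeometry.SAW.law D.carrier δ (a δ) (b δ)) id ν := by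
  constructor
  · rintro ⟨P, -, hP⟩ D a b hab
    exact ⟨P D, hP D a b hab⟩
  · intro h
    -- one reference approximation and its limit per domain
    have key : ∀ D : DobrushinDomain, ∃ (a b : ℝ → Site 2) (ν : Measure (CurveClass ℂ)),
        IsEndpointApprox D a b ∧ TendstoLaw (fun δ (γ : DomainSAW D.carrier δ (a δ) (b δ)) => γ.curve)
          (fun δ => law D.carrier δ (a δ) (b δ)) id ν := by
      intro D
      obtain ⟨a, b, hab⟩ := SAW.exists_isEndpointApprox D
      obtain ⟨ν, hν⟩ := h D a b hab
      exact ⟨a, b, ν, hab, hν⟩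
    choose a₀ b₀ P hab₀ hP using key
    refine ⟨P, fun D => ⟨isProbabilityMeasure_of_tendstoLaw (hab₀ D) (hP D),
      ae_chordal_of_tendstoLaw (hab₀ D) (hP D)⟩, fun D a b hab => ?_⟩
    obtain ⟨ν, hν⟩ := h D a b hab
    have hνP : ν = P D := eq_of_tendstoLaw (h D) hab (hab₀ D) hν (hP D)
    rw [← hνP]
    exact hν

end Summit.CriticalPhenomena.SAWScalingLimit.Theorems.SAWRestrictionRigidityLimitExists

end
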